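import Summits.SmoothPoincare4.SmoothPoincare4.Theorems.RootDecompAEDoublesShadowTwoStubRoeSound
import HarnessLib

/-!
# `stub_roeSound : RoeSound` for the line `grade_four_ac` (crux item stmt-SmoothPoincare4-32183, crux `RootDecompAE.DoublesBeyondShadowTwo`)

Theorems-lane text (decomp-sp4 writer g11, 2026-08-30; critic decomp-sp4-crit-1 ruling on FILE 2 option (ii), CRITIC-LEDGER row 156,
HOME/STATUS.md l.1031).  The registered NAME-shaped stub `stub_roeSound : RoeSound` of `Cruxes/DoublesBeyondShadowTwo/Lines/grade_four_ac.lean`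
has the SAME name and the SAME registered signature text (`RoeSound`) as the stub of `Cruxes/DoublesShadowTwo/Lines/grade_two_ac.lean`
closed by `Summit.SmoothPoincare4.SmoothPoincare4.Theorems.RootDecompAEDoublesShadowTwoStubRoeSound.stub_roeSound`, and the two skeletons'
`namespace Roe … end Roe` blocks and `def RoeSound` are BYTE-IDENTICAL (grade_two_ac.lean l.456–494 / 523–525 = grade_four_ac.lean
l.567–605 / 647–649; sha256 of the extracted ranges 306ed563… / 73faf4dc…).  The stub registry is per crux item and `--supports` takes one
item, so this one-theorem sibling records the credit on stmt-SmoothPoincare4-32183: the constant `RoeSound` it states is the certified twin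
of the imported module (critic ruling (x) BODY TWIN holds by reference; ruling (y): this file declares exactly one constant).
Rung 0 of SmoothPoincare4; nothing here touches the summit.
-/

set_option linter.dupNamespace false

namespace Summit.SmoothPoincare4.SmoothPoincare4.Theorems.RootDecompAEDoublesBeyondShadowTwoStubRoeSound

open Summit.SmoothPoincare4.SmoothPoincare4.Theorems.RootDecompAEDoublesShadowTwoStubRoeSound

/-- **The registered stub of the line `grade_four_ac`** (registered signature: the bare name `RoeSound`; byte-identical twin of the
`grade_two_ac` stub): a recursive one-occurrence elimination certificate implies Andrews–Curtis triviality, without stabilisation. -/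
theorem stub_roeSound : RoeSound :=
  Summit.SmoothPoincare4.SmoothPoincare4.Theorems.RootDecompAEDoublesShadowTwoStubRoeSound.stub_roeSound

end Summit.SmoothPoincare4.SmoothPoincare4.Theorems.RootDecompAEDoublesBeyondShadowTwoStubRoeSound
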